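import Literature.NumberTheory.Rogawski1990.ArchBouazizClassMap          -- ★ p851469: `bzClassMap`, `RegS` (via ★ `ArchCartanCoordinates`)
import HarnessLib

/-!
# CLASS TUBES NEAR A REGULAR BASE CLASS: one chart type, regularity and bounded split coordinates on `{c : dist (bzClassMap S c) b < ε}`
# (Bouaziz 1994 §5.1 p. 588 «bon voisinage d'un élément semi-simple régulier»; Shelstad 1979 §4; Rogawski 1990 §3.6, §8.2)

Topic `NumberTheory/Rogawski1990`; namespace `Literature.NumberTheory.Rogawski1990`.  THEOREMS ONLY (no `def`, no instance, no notation, no axiom, no named fact,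
no `sorry`); group-free over a finite index type `W`.  Cell `pub/hodgecm-mathlib`, crux H413 (`stmt-HodgeConjecture-24833`), line LH3 (closer stub `stub_N9`), letter L3′,
SURJ-OF-FORWARD road (RULINGS #22∕#23), organ (Σ-REG) «local surjectivity at a REGULAR base class» (binder F0P3a-p04 (g25)), piece **(Σ4d) «CLASS TUBES»** (LH10-p01 (g5) NAMES
2026-09-02T12:56:27Z).  Author LH3-p04 (g5).  Count-neutral.

WHAT.  Bouaziz (ÉNS 27 §5.1 p. 588) reduces the surjectivity of `J^st_G` to a good invariant neighbourhood of each semisimple class; at a REGULAR class it meets ONE Cartan type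
and consists of regular elements.  The stable class of a chart point `(S, c)` is read by the per-place CLASS MAP `bzClassMap S c w = (t, d, u)` (★ `ArchBouazizClassMap`); everything
rests on ONE per-place invariant: **`t² · conj d − 4` is REAL `= (eˣ − e⁻ˣ)² ≥ 0` on a SPLIT value and REAL `= 2 Re(e^{iθ₀} conj e^{iθ₂}) − 2 ≤ 0` on a COMPACT value**, while `|d| = 1`
on every class value and `t² − 4d` vanishes exactly on the walls.  §1 the invariants (`sq_sub_four_mul_bzClassMap_of_mem ∕ _of_not_mem`, `norm_bzClassMap_det`,
**`mem_regS_iff_bzClassMap`**); §2 the tubes near `b` with `∀ w, (b w).1² ≠ 4 (b w).2.1`: **`exists_forall_mem_regS_of_dist_bzClassMap_lt`**, **`exists_forall_chart_eq_of_dist_bzClassMap_lt`**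
(ONE chart near a regular class; vacuous off every image), **`abs_coord_zero_le_log_of_dist_bzClassMap_lt`** (`|x_w| ≤ log (‖(b w).1‖ + ε + 1)`), package `exists_classTube`; the heads
`mem_regS_of_sq_ne_four_mul` ∕ `exists_forall_chart_eq_of_dist_bzClassMap_lt` ∕ `abs_coord_zero_le_log_of_dist_bzClassMap_lt` are the binders `hreg1` ∕ `htype` ∕ `hxbd` of the (Σ-REG)
adapter `bzLocalSurjRegular_of_parts` (F0P3a-p04 (g25), `ArchBouazizRegularGerms`) TOKEN FOR TOKEN.
§3 (ED. 2, the per-place half of the (Σ-WALL) brick (W0b), LH1-p03 (g7) imports it): at a CENTRAL place of a wall base class (`t_w² = 4 d_w`) the tube pins the coordinates to the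
wall — **`exists_forall_norm_sq_sub_four_mul_lt_of_central`** (`‖t² − 4d‖ < η` on a small tube), **`exists_forall_sq_exp_sub_lt_of_central`** (`(eˣʷ−e⁻ˣʷ)² < η` on a split chart),
**`exists_forall_norm_circleExp_sub_sq_lt_of_central`** (`‖e^{iθ₀} − e^{iθ₂}‖² < η` on a compact chart); the regular places of a wall class are read through §2's per-place
`exists_pos_not_split_and_compact_near` in LH1-p03's `ArchBouazizClassMapWallTube` (W0a).
HONEST LABEL: HC_CM is proved only modulo the 7 printed citations (2 remaining: hLiu418 = stmt-HodgeConjecture-24832, h413 = stmt-HodgeConjecture-24833) until rung 0 closes;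
this file is coordinate geometry of the class map and pays nothing by itself.

## References
* [Bouaziz1994IntegralesOrbitales] A. Bouaziz, *Intégrales orbitales sur les groupes de Lie réductifs*, Ann. Sci. ÉNS (4) 27 (1994) 573–609, §2.3 p. 578, §5.1 p. 588.
* [Shelstad1979] D. Shelstad, *Characters and inner forms of a quasi-split group over ℝ*, Compositio Math. 39 (1979), §4 pp. 22–25 (`T_reg`, Cartan types, Cayley data).
* [Rogawski1990] J. D. Rogawski, *Automorphic Representations of Unitary Groups in Three Variables*, Ann. of Math. Stud. 123 (1990), §3.6 p. 31 (stable classes by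
  eigenvalues), §8.2 p. 122.
-/

set_option autoImplicit false

noncomputable section

open Complex Set Function Real Metric
open Literature.NumberTheory.Automorphic.ArchCartan

namespace Literature.NumberTheory.Rogawski1990

variable {W : Type*}

/-! ## §1 The per-place invariants of a class value -/

section Invariants

variable [DecidableEq W]

/-- `eˣ · e⁻ˣ = 1` in `ℂ`. [folklore] -/
private theorem ofReal_exp_mul_ofReal_exp_neg (x : ℝ) : ((Real.exp x : ℝ) : ℂ) * ((Real.exp (-x) : ℝ) : ℂ) = 1 := by
  rw [← ofReal_mul, ← Real.exp_add, add_neg_cancel, Real.exp_zero, ofReal_one]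

/-- `z · conj z = 1` for a point of the unit circle. [folklore] -/
private theorem circle_mul_conj (z : Circle) : (z : ℂ) * (starRingEnd ℂ) (z : ℂ) = 1 := by
  rw [← Circle.coe_inv_eq_conj, ← Circle.coe_mul, mul_inv_cancel, Circle.coe_one]

/-- **The discriminant at a SPLIT place**: `t² − 4d = (eˣ − e⁻ˣ)² · e^{2iθ}` for `t = (eˣ+e⁻ˣ)e^{iθ}`, `d = e^{2iθ}`. [cite: Rogawski1990, §3.6 p. 31]
[cite: Shelstad1979, §4 p. 23] -/
theorem sq_sub_four_mul_bzClassMap_of_mem {S : Finset W} {w : W} (hw : w ∈ S) (c : W → Fin 3 → ℝ) :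
    (bzClassMap S c w).1 ^ 2 - 4 * (bzClassMap S c w).2.1 =
      (((Real.exp (c w 0) - Real.exp (-(c w 0))) ^ 2 : ℝ) : ℂ) * (Circle.exp (c w 2) : ℂ) ^ 2 := by
  rw [bzClassMap_of_mem hw]
  have h1 := ofReal_exp_mul_ofReal_exp_neg (c w 0)
  simp only [ofReal_add, ofReal_sub, ofReal_pow]
  linear_combination (4 * (Circle.exp (c w 2) : ℂ) ^ 2) * h1

/-- **The discriminant at a COMPACT place**: `t² − 4d = (e^{iθ₀} − e^{iθ₂})²` for `t = e^{iθ₀} + e^{iθ₂}`, `d = e^{iθ₀} e^{iθ₂}`. [cite: Rogawski1990, §3.6 p. 31]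
[cite: Shelstad1979, §4 p. 23] -/
theorem sq_sub_four_mul_bzClassMap_of_not_mem {S : Finset W} {w : W} (hw : w ∉ S) (c : W → Fin 3 → ℝ) :
    (bzClassMap S c w).1 ^ 2 - 4 * (bzClassMap S c w).2.1 = ((Circle.exp (c w 0) : ℂ) - (Circle.exp (c w 2) : ℂ)) ^ 2 := by
  rw [bzClassMap_of_not_mem hw]
  ring

/-- **Every class value has a unimodular determinant entry**: `‖d_w‖ = 1`. [cite: Rogawski1990, §3.6 p. 31] -/
theorem norm_bzClassMap_det (S : Finset W) (c : W → Fin 3 → ℝ) (w : W) : ‖(bzClassMap S c w).2.1‖ = 1 := by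
  by_cases hw : w ∈ S
  · rw [bzClassMap_of_mem hw]
    simp only [norm_pow, Circle.norm_coe, one_pow]
  · rw [bzClassMap_of_not_mem hw]
    simp only [norm_mul, Circle.norm_coe, mul_one]

/-- **The modulus of the trace at a SPLIT place**: `‖t_w‖ = eˣ + e⁻ˣ`. [cite: Rogawski1990, §3.6 p. 31] -/
theorem norm_bzClassMap_tr_of_mem {S : Finset W} {w : W} (hw : w ∈ S) (c : W → Fin 3 → ℝ) :
    ‖(bzClassMap S c w).1‖ = Real.exp (c w 0) + Real.exp (-(c w 0)) := by
  rw [bzClassMap_of_mem hw]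
  simp only [norm_mul, Circle.norm_coe, mul_one, Complex.norm_real, Real.norm_eq_abs]
  exact abs_of_pos (add_pos (Real.exp_pos _) (Real.exp_pos _))

/-- **The invariant `t² · conj d − 4` at a SPLIT place is the non-negative real `(eˣ − e⁻ˣ)²`.** [cite: Shelstad1979, §4 p. 23] [cite: Bouaziz1994IntegralesOrbitales, §5.1 p. 588] -/
theorem sq_mul_conj_det_sub_four_of_mem {S : Finset W} {w : W} (hw : w ∈ S) (c : W → Fin 3 → ℝ) :
    (bzClassMap S c w).1 ^ 2 * (starRingEnd ℂ) (bzClassMap S c w).2.1 - 4 = (((Real.exp (c w 0) - Real.exp (-(c w 0))) ^ 2 : ℝ) : ℂ) := by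
  rw [bzClassMap_of_mem hw]
  have h1 := ofReal_exp_mul_ofReal_exp_neg (c w 0)
  have h2 := circle_mul_conj (Circle.exp (c w 2))
  simp only [map_pow, ofReal_add, ofReal_sub, ofReal_pow]
  linear_combination (4 : ℂ) * h1 +
    (((Real.exp (c w 0) : ℝ) : ℂ) + ((Real.exp (-(c w 0)) : ℝ) : ℂ)) ^ 2 * ((Circle.exp (c w 2) : ℂ) * (starRingEnd ℂ) (Circle.exp (c w 2) : ℂ) + 1) * h2

/-- **The invariant `t² · conj d − 4` at a COMPACT place is the non-positive real `2 Re(e^{iθ₀} · conj e^{iθ₂}) − 2`.** [cite: Shelstad1979, §4 p. 23]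
[cite: Bouaziz1994IntegralesOrbitales, §5.1 p. 588] -/
theorem sq_mul_conj_det_sub_four_of_not_mem {S : Finset W} {w : W} (hw : w ∉ S) (c : W → Fin 3 → ℝ) :
    (bzClassMap S c w).1 ^ 2 * (starRingEnd ℂ) (bzClassMap S c w).2.1 - 4 =
      ((2 * ((Circle.exp (c w 0) : ℂ) * (starRingEnd ℂ) (Circle.exp (c w 2) : ℂ)).re - 2 : ℝ) : ℂ) := by
  rw [bzClassMap_of_not_mem hw]
  have h0 := circle_mul_conj (Circle.exp (c w 0))
  have h2 := circle_mul_conj (Circle.exp (c w 2))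
  have hre : (((2 * ((Circle.exp (c w 0) : ℂ) * (starRingEnd ℂ) (Circle.exp (c w 2) : ℂ)).re : ℝ) : ℂ)) =
      (Circle.exp (c w 0) : ℂ) * (starRingEnd ℂ) (Circle.exp (c w 2) : ℂ) + (starRingEnd ℂ) ((Circle.exp (c w 0) : ℂ) * (starRingEnd ℂ) (Circle.exp (c w 2) : ℂ)) :=
    (Complex.add_conj _).symm
  simp only [map_mul]
  rw [ofReal_sub, hre, map_mul, Complex.conj_conj, ofReal_ofNat]
  linear_combination ((Circle.exp (c w 0) : ℂ) * (starRingEnd ℂ) (Circle.exp (c w 2) : ℂ) + 2) * h0 +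
    ((starRingEnd ℂ) (Circle.exp (c w 0) : ℂ) * (Circle.exp (c w 2) : ℂ) + 2 * ((Circle.exp (c w 0) : ℂ) * (starRingEnd ℂ) (Circle.exp (c w 0) : ℂ))) * h2

/-- The split invariant is non-negative. [cite: Shelstad1979, §4 p. 23] -/
theorem zero_le_splitInvariant (x : ℝ) : 0 ≤ (Real.exp x - Real.exp (-x)) ^ 2 := sq_nonneg _

/-- The compact invariant is non-positive (`Re(z) ≤ ‖z‖ = 1` for a product of two circle points). [cite: Shelstad1979, §4 p. 23] -/
theorem compactInvariant_le_zero (a b : ℝ) : 2 * ((Circle.exp a : ℂ) * (starRingEnd ℂ) (Circle.exp b : ℂ)).re - 2 ≤ 0 := by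
  have h : ((Circle.exp a : ℂ) * (starRingEnd ℂ) (Circle.exp b : ℂ)).re ≤ 1 := by
    refine (Complex.re_le_norm _).trans ?_
    rw [norm_mul, Complex.norm_conj, Circle.norm_coe, Circle.norm_coe, mul_one]
  linarith

/-- **REGULARITY IS READ OFF THE CLASS DATA**: `c ∈ RegS S ↔ ∀ w, t_w² ≠ 4 d_w` (distinct block eigenvalues at every place: `x_w ≠ 0` at a split place, `e^{iθ₀} ≠ e^{iθ₂}`
at a compact place). [cite: Shelstad1979, §4 p. 22] [cite: Rogawski1990, §3.6 p. 31] -/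
theorem mem_regS_iff_bzClassMap (S : Finset W) (c : W → Fin 3 → ℝ) :
    c ∈ RegS S ↔ ∀ w, (bzClassMap S c w).1 ^ 2 ≠ 4 * (bzClassMap S c w).2.1 := by
  rw [mem_regS_iff]
  constructor
  · rintro ⟨hc, hs⟩ w
    rw [Ne, ← sub_eq_zero]
    by_cases hw : w ∈ S
    · rw [sq_sub_four_mul_bzClassMap_of_mem hw, mul_eq_zero, not_or]
      refine ⟨?_, pow_ne_zero _ (Circle.coe_ne_zero _)⟩
      rw [ofReal_eq_zero, sq_eq_zero_iff, sub_eq_zero, Real.exp_eq_exp]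
      intro h
      exact hs w hw (by linarith)
    · rw [sq_sub_four_mul_bzClassMap_of_not_mem hw, sq_eq_zero_iff, sub_eq_zero, Circle.coe_inj]
      exact hc w hw
  · intro h
    refine ⟨fun w hw heq => h w ?_, fun w hw h0 => h w ?_⟩
    · rw [← sub_eq_zero, sq_sub_four_mul_bzClassMap_of_not_mem hw, heq, sub_self, zero_pow two_ne_zero]
    · rw [← sub_eq_zero, sq_sub_four_mul_bzClassMap_of_mem hw, h0, neg_zero, sub_self]
      simp

/-- **(Σ-REG) binder `hreg1`**: distinct block eigenvalues in the class data at every place ⇒ the chart point is regular. [cite: Shelstad1979, §4 p. 22]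
[cite: Rogawski1990, §3.6 p. 31] -/
theorem mem_regS_of_sq_ne_four_mul (S : Finset W) (c : W → Fin 3 → ℝ) (h : ∀ w, (bzClassMap S c w).1 ^ 2 ≠ 4 * (bzClassMap S c w).2.1) : c ∈ RegS S :=
  (mem_regS_iff_bzClassMap S c).2 h

end Invariants

/-! ## §2 Tubes near a regular base class -/

section Tubes

variable [Fintype W] [DecidableEq W]

omit [DecidableEq W] in
/-- A positive lower bound for finitely many positive radii. [folklore] -/
private theorem exists_pos_forall_le (δ : W → ℝ) (hδ : ∀ w, 0 < δ w) : ∃ ε : ℝ, 0 < ε ∧ ∀ w, ε ≤ δ w := by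
  cases isEmpty_or_nonempty W with
  | inl h => exact ⟨1, one_pos, fun w => isEmptyElim w⟩
  | inr h =>
    obtain ⟨w₀, hw₀⟩ := Finite.exists_min δ
    exact ⟨δ w₀, hδ w₀, hw₀⟩

/-- The class tube controls each place: `dist (bzClassMap S c w) (b w) ≤ dist (bzClassMap S c) b` (sup metric over the places). [cite: Bouaziz1994IntegralesOrbitales, §5.1 p. 588] -/
theorem dist_bzClassMap_apply_le (S : Finset W) (c : W → Fin 3 → ℝ) (b : W → ℂ × ℂ × ℂ) (w : W) :
    dist (bzClassMap S c w) (b w) ≤ dist (bzClassMap S c) b :=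
  dist_le_pi_dist _ _ w

/-- **REGULARITY ON THE TUBE**: near a base class `b` with `t_w² ≠ 4 d_w` at every place, every chart point of every chart whose class is `ε`-near `b` is regular (the
discriminant `t² − 4d` is continuous and non-zero at `b w`). [cite: Bouaziz1994IntegralesOrbitales, §5.1 p. 588] [cite: Shelstad1979, §4 p. 22] -/
theorem exists_forall_mem_regS_of_dist_bzClassMap_lt (b : W → ℂ × ℂ × ℂ) (hb : ∀ w, (b w).1 ^ 2 ≠ 4 * (b w).2.1) :
    ∃ ε : ℝ, 0 < ε ∧ ∀ (S : Finset W) (c : W → Fin 3 → ℝ), dist (bzClassMap S c) b < ε → c ∈ RegS S := by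
  -- per place: the discriminant stays non-zero on a ball around `b w`
  have hδ : ∀ w, ∃ δ : ℝ, 0 < δ ∧ ∀ P : ℂ × ℂ × ℂ, dist P (b w) < δ → P.1 ^ 2 ≠ 4 * P.2.1 := by
    intro w
    have hcont : Continuous fun P : ℂ × ℂ × ℂ => P.1 ^ 2 - 4 * P.2.1 := by fun_prop
    have hne : (fun P : ℂ × ℂ × ℂ => P.1 ^ 2 - 4 * P.2.1) (b w) ≠ 0 := sub_ne_zero.2 (hb w)
    have hev := (hcont.continuousAt (x := b w)).eventually_ne hne
    obtain ⟨δ, hδ, hball⟩ := Metric.eventually_nhds_iff.1 hev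
    exact ⟨δ, hδ, fun P hP => sub_ne_zero.1 (hball hP)⟩
  choose δ hδ hδP using hδ
  obtain ⟨ε, hε, hεδ⟩ := exists_pos_forall_le δ hδ
  refine ⟨ε, hε, fun S c hc => (mem_regS_iff_bzClassMap S c).2 fun w => hδP w _ ?_⟩
  exact ((dist_bzClassMap_apply_le S c b w).trans_lt hc).trans_le (hεδ w)

omit [Fintype W] in
/-- **ONE CHART TYPE PER PLACE near a regular value**: for `P₀ : ℂ × ℂ × ℂ` with `P₀.1² ≠ 4 P₀.2.1` there is `δ > 0` such that no SPLIT value and COMPACT value of the class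
map at the same place are both `δ`-near `P₀` (if `‖P₀.2.1‖ ≠ 1` no class value is near at all; otherwise `z := P₀.1² conj P₀.2.1 − 4 ≠ 0` and the two REAL invariants, `≥ 0`
and `≤ 0`, cannot both be `‖z‖∕2`-near `z`). [cite: Bouaziz1994IntegralesOrbitales, §5.1 p. 588] [cite: Shelstad1979, §4 p. 23] -/
theorem exists_pos_not_split_and_compact_near (P₀ : ℂ × ℂ × ℂ) (h : P₀.1 ^ 2 ≠ 4 * P₀.2.1) :
    ∃ δ : ℝ, 0 < δ ∧ ∀ (S S' : Finset W) (c c' : W → Fin 3 → ℝ) (w : W), w ∈ S → w ∉ S' →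
      dist (bzClassMap S c w) P₀ < δ → dist (bzClassMap S' c' w) P₀ < δ → False := by
  by_cases hd : ‖P₀.2.1‖ = 1
  · -- `z := t₀² conj d₀ − 4 ≠ 0`
    set z : ℂ := P₀.1 ^ 2 * (starRingEnd ℂ) P₀.2.1 - 4 with hz_def
    have hz : z ≠ 0 := by
      intro hz0
      apply h
      have hdd : P₀.2.1 * (starRingEnd ℂ) P₀.2.1 = 1 := by
        rw [Complex.mul_conj, Complex.normSq_eq_norm_sq, hd, one_pow, ofReal_one]
      have : P₀.1 ^ 2 * (starRingEnd ℂ) P₀.2.1 = 4 := sub_eq_zero.1 hz0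
      linear_combination P₀.2.1 * this - P₀.1 ^ 2 * hdd
    have hzpos : 0 < ‖z‖ / 2 := by positivity
    have hcont : Continuous fun P : ℂ × ℂ × ℂ => P.1 ^ 2 * (starRingEnd ℂ) P.2.1 - 4 := by fun_prop
    have hev : ∀ᶠ P in nhds P₀, dist (P.1 ^ 2 * (starRingEnd ℂ) P.2.1 - 4) z < ‖z‖ / 2 := by
      have ht : Filter.Tendsto (fun P : ℂ × ℂ × ℂ => P.1 ^ 2 * (starRingEnd ℂ) P.2.1 - 4) (nhds P₀) (nhds z) := hcont.continuousAt
      exact ht.eventually (Metric.ball_mem_nhds z hzpos)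
    obtain ⟨δ, hδ, hball⟩ := Metric.eventually_nhds_iff.1 hev
    refine ⟨δ, hδ, fun S S' c c' w hw hw' hP hQ => ?_⟩
    have hP' := hball hP
    have hQ' := hball hQ
    rw [sq_mul_conj_det_sub_four_of_mem hw] at hP'
    rw [sq_mul_conj_det_sub_four_of_not_mem hw'] at hQ'
    set r : ℝ := (Real.exp (c w 0) - Real.exp (-(c w 0))) ^ 2 with hr_def
    set s : ℝ := 2 * ((Circle.exp (c' w 0) : ℂ) * (starRingEnd ℂ) (Circle.exp (c' w 2) : ℂ)).re - 2 with hs_def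
    have hr : 0 ≤ r := zero_le_splitInvariant _
    have hs : s ≤ 0 := compactInvariant_le_zero _ _
    rw [dist_eq_norm] at hP' hQ'
    -- `‖z‖ ≤ ‖z − r‖ + ‖r‖ < ‖z‖/2 + r`, similarly with `−s`
    have h1 : ‖z‖ < ‖z‖ / 2 + r := by
      have hnr : ‖(r : ℂ)‖ = r := by rw [Complex.norm_real, Real.norm_eq_abs, abs_of_nonneg hr]
      have hsym : ‖z - (r : ℂ)‖ = ‖(r : ℂ) - z‖ := norm_sub_rev _ _
      linarith [norm_sub_norm_le z (r : ℂ)]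
    have h2 : ‖z‖ < ‖z‖ / 2 - s := by
      have hns : ‖(s : ℂ)‖ = -s := by rw [Complex.norm_real, Real.norm_eq_abs, abs_of_nonpos hs]
      have hsym : ‖z - (s : ℂ)‖ = ‖(s : ℂ) - z‖ := norm_sub_rev _ _
      linarith [norm_sub_norm_le z (s : ℂ)]
    -- `r − s = ‖r − s‖ ≤ ‖r − z‖ + ‖z − s‖ < ‖z‖`
    have h3 : r - s < ‖z‖ := by
      have hrs : ‖((r : ℂ)) - (s : ℂ)‖ = r - s := by
        rw [← ofReal_sub, Complex.norm_real, Real.norm_eq_abs, abs_of_nonneg (by linarith)]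
      have htri : ‖((r : ℂ)) - (s : ℂ)‖ ≤ ‖(r : ℂ) - z‖ + ‖z - (s : ℂ)‖ := norm_sub_le_norm_sub_add_norm_sub _ _ _
      have hsym : ‖z - (s : ℂ)‖ = ‖(s : ℂ) - z‖ := norm_sub_rev _ _
      linarith
    linarith
  · -- `‖d₀‖ ≠ 1`: no class value is `|‖d₀‖ − 1|`-near `P₀`
    refine ⟨|‖P₀.2.1‖ - 1|, abs_pos.2 (sub_ne_zero.2 hd), fun S S' c c' w hw _ hP _ => ?_⟩
    have h1 : dist (bzClassMap S c w).2.1 P₀.2.1 ≤ dist (bzClassMap S c w) P₀ :=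
      calc dist (bzClassMap S c w).2.1 P₀.2.1 ≤ dist (bzClassMap S c w).2 P₀.2 := by
            rw [Prod.dist_eq (x := (bzClassMap S c w).2)]; exact le_max_left _ _
        _ ≤ dist (bzClassMap S c w) P₀ := by rw [Prod.dist_eq (x := bzClassMap S c w)]; exact le_max_right _ _
    have h2 : |‖P₀.2.1‖ - 1| ≤ dist (bzClassMap S c w).2.1 P₀.2.1 := by
      rw [dist_eq_norm, ← norm_bzClassMap_det S c w, abs_sub_comm]
      exact abs_norm_sub_norm_le _ _
    linarith

/-- **ONE CHART NEAR A REGULAR BASE CLASS**: near `b` with `t_w² ≠ 4 d_w` at every place, all chart points of ALL charts whose class is `ε`-near `b` belong to ONE AND THE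
SAME chart `S` (the compact-type image `|t| ≤ 2` and the split-type image `|t| ≥ 2` meet only on the walls `t² = 4d`; for `b` off every image the statement is vacuous).
[cite: Bouaziz1994IntegralesOrbitales, §5.1 p. 588] [cite: Shelstad1979, §4 pp. 22–23] -/
theorem exists_forall_chart_eq_of_dist_bzClassMap_lt (b : W → ℂ × ℂ × ℂ) (hb : ∀ w, (b w).1 ^ 2 ≠ 4 * (b w).2.1) :
    ∃ ε : ℝ, 0 < ε ∧ ∀ (S S' : Finset W) (c c' : W → Fin 3 → ℝ),
      dist (bzClassMap S c) b < ε → dist (bzClassMap S' c') b < ε → S = S' := by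
  choose δ hδ hδP using fun w => exists_pos_not_split_and_compact_near (W := W) (b w) (hb w)
  obtain ⟨ε, hε, hεδ⟩ := exists_pos_forall_le δ hδ
  refine ⟨ε, hε, fun S S' c c' hc hc' => Finset.ext fun w => ?_⟩
  have hw1 : dist (bzClassMap S c w) (b w) < δ w := ((dist_bzClassMap_apply_le S c b w).trans_lt hc).trans_le (hεδ w)
  have hw2 : dist (bzClassMap S' c' w) (b w) < δ w := ((dist_bzClassMap_apply_le S' c' b w).trans_lt hc').trans_le (hεδ w)
  constructor
  · intro h1
    by_contra h2
    exact hδP w S S' c c' w h1 h2 hw1 hw2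
  · intro h2
    by_contra h1
    exact hδP w S' S c' c w h2 h1 hw2 hw1

/-- `e^{|x|} ≤ eˣ + e⁻ˣ`. [folklore] -/
private theorem exp_abs_le_exp_add_exp_neg (x : ℝ) : Real.exp |x| ≤ Real.exp x + Real.exp (-x) := by
  rcases le_or_gt 0 x with hx | hx
  · rw [abs_of_nonneg hx]
    linarith [Real.exp_pos (-x)]
  · rw [abs_of_neg hx]
    linarith [Real.exp_pos x]

omit [DecidableEq W] in
/-- The trace entry is controlled by the class tube: `‖t_w‖ < ‖(b w).1‖ + ε`. [cite: Bouaziz1994IntegralesOrbitales, §5.1 p. 588] [cite: Rogawski1990, §3.6 p. 31] -/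
theorem norm_bzClassMap_tr_lt_of_dist_lt [DecidableEq W] (S : Finset W) (c : W → Fin 3 → ℝ) (b : W → ℂ × ℂ × ℂ) {ε : ℝ} (w : W)
    (h : dist (bzClassMap S c) b < ε) : ‖(bzClassMap S c w).1‖ < ‖(b w).1‖ + ε := by
  have h1 : dist (bzClassMap S c w).1 (b w).1 < ε :=
    calc dist (bzClassMap S c w).1 (b w).1 ≤ dist (bzClassMap S c w) (b w) := by
          rw [Prod.dist_eq (x := bzClassMap S c w)]; exact le_max_left _ _
      _ ≤ dist (bzClassMap S c) b := dist_bzClassMap_apply_le S c b w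
      _ < ε := h
  have h2 := norm_sub_norm_le (bzClassMap S c w).1 (b w).1
  rw [← dist_eq_norm] at h2
  linarith

/-- **(Σ-REG) binder `hxbd` — BOUNDED SPLIT COORDINATES ON A TUBE**: if the class of `(S, c)` is `ε`-near `b` then `|x_w| ≤ log (‖(b w).1‖ + ε + 1)` at every split place
`w ∈ S` (`e^{|x|} ≤ eˣ + e⁻ˣ = ‖t_w‖ < ‖(b w).1‖ + ε`) — the `R` of (Σ4b) `exists_archSmooth₂_stOrbFamH_ne_zero (S) (R)` on the tube.
[cite: Bouaziz1994IntegralesOrbitales, §5.1 p. 588] [cite: Rogawski1990, §3.6 p. 31] -/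
theorem abs_coord_zero_le_log_of_dist_bzClassMap_lt (S : Finset W) (c : W → Fin 3 → ℝ) (b : W → ℂ × ℂ × ℂ) (ε : ℝ) (w : W) (hw : w ∈ S)
    (h : dist (bzClassMap S c) b < ε) : |c w 0| ≤ Real.log (‖(b w).1‖ + ε + 1) := by
  have h1 := norm_bzClassMap_tr_lt_of_dist_lt S c b w h
  rw [norm_bzClassMap_tr_of_mem hw] at h1
  have h2 : Real.exp |c w 0| < ‖(b w).1‖ + ε + 1 := by linarith [exp_abs_le_exp_add_exp_neg (c w 0)]
  have hpos : 0 < ‖(b w).1‖ + ε + 1 := (Real.exp_pos _).trans h2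
  rw [Real.le_log_iff_exp_le hpos]
  exact h2.le

/-- **BOUNDED SPLIT COORDINATES ON THE UNIT TUBE, uniform in the place**: `|x_w| ≤ log (‖b‖ + 2)`. [cite: Bouaziz1994IntegralesOrbitales, §5.1 p. 588] -/
theorem abs_coord_zero_le_log_norm_of_dist_bzClassMap_lt_one (b : W → ℂ × ℂ × ℂ) {S : Finset W} {c : W → Fin 3 → ℝ} (h : dist (bzClassMap S c) b < 1)
    {w : W} (hw : w ∈ S) : |c w 0| ≤ Real.log (‖b‖ + 2) := by
  refine (abs_coord_zero_le_log_of_dist_bzClassMap_lt S c b 1 w hw h).trans (Real.log_le_log (by positivity) ?_)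
  have h3 : ‖(b w).1‖ ≤ ‖b‖ := (norm_fst_le (b w)).trans (norm_le_pi_norm b w)
  linarith

/-- **THE CLASS TUBE PACKAGE at a regular base class** (consumed by the (Σ-REG) payer): one radius `ε ∈ (0, 1]` below which (i) every chart point with class `ε`-near `b`
is regular with split coordinates bounded by `log (‖b‖ + 2)`, and (ii) all such chart points belong to one chart. [cite: Bouaziz1994IntegralesOrbitales, §5.1 p. 588]
[cite: Shelstad1979, §4 pp. 22–23] -/
theorem exists_classTube (b : W → ℂ × ℂ × ℂ) (hb : ∀ w, (b w).1 ^ 2 ≠ 4 * (b w).2.1) :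
    ∃ ε : ℝ, 0 < ε ∧ ε ≤ 1 ∧
      (∀ (S : Finset W) (c : W → Fin 3 → ℝ), dist (bzClassMap S c) b < ε → c ∈ RegS S ∧ ∀ w ∈ S, |c w 0| ≤ Real.log (‖b‖ + 2)) ∧
      ∀ (S S' : Finset W) (c c' : W → Fin 3 → ℝ), dist (bzClassMap S c) b < ε → dist (bzClassMap S' c') b < ε → S = S' := by
  obtain ⟨ε₁, hε₁, h₁⟩ := exists_forall_mem_regS_of_dist_bzClassMap_lt b hb
  obtain ⟨ε₂, hε₂, h₂⟩ := exists_forall_chart_eq_of_dist_bzClassMap_lt b hb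
  refine ⟨min 1 (min ε₁ ε₂), lt_min one_pos (lt_min hε₁ hε₂), min_le_left _ _, fun S c hc => ⟨h₁ S c ?_, fun w hw => ?_⟩, fun S S' c c' hc hc' => h₂ S S' c c' ?_ ?_⟩
  · exact hc.trans_le ((min_le_right _ _).trans (min_le_left _ _))
  · exact abs_coord_zero_le_log_norm_of_dist_bzClassMap_lt_one b (hc.trans_le (min_le_left _ _)) hw
  · exact hc.trans_le ((min_le_right _ _).trans (min_le_right _ _))
  · exact hc'.trans_le ((min_le_right _ _).trans (min_le_right _ _))

end Tubes

/-! ## §3 Near-wall readings at a central place of a WALL base class (ED. 2, per-place half of (W0b)) -/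

section WallClass
variable [Fintype W] [DecidableEq W]

/-- **NEAR-WALL READING AT A CENTRAL PLACE**: if `t_w² = 4 d_w` for the base class then on a small enough tube the discriminant `‖t² − 4d‖` of every chart point is `< η` at `w`.
[cite: Bouaziz1994IntegralesOrbitales, §5.1 p. 588] [cite: Shelstad1979, §4 p. 25] -/
theorem exists_forall_norm_sq_sub_four_mul_lt_of_central (b : W → ℂ × ℂ × ℂ) {w : W} (hw : (b w).1 ^ 2 = 4 * (b w).2.1) {η : ℝ} (hη : 0 < η) :
    ∃ ε : ℝ, 0 < ε ∧ ∀ (S : Finset W) (c : W → Fin 3 → ℝ), dist (bzClassMap S c) b < ε → ‖(bzClassMap S c w).1 ^ 2 - 4 * (bzClassMap S c w).2.1‖ < η := by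
  have hcont : Continuous fun P : ℂ × ℂ × ℂ => P.1 ^ 2 - 4 * P.2.1 := by fun_prop
  have h0 : (fun P : ℂ × ℂ × ℂ => P.1 ^ 2 - 4 * P.2.1) (b w) = 0 := sub_eq_zero.2 hw
  have hev : ∀ᶠ P in nhds (b w), dist (P.1 ^ 2 - 4 * P.2.1) 0 < η := by
    have ht : Filter.Tendsto (fun P : ℂ × ℂ × ℂ => P.1 ^ 2 - 4 * P.2.1) (nhds (b w)) (nhds 0) := by
      rw [← h0]; exact hcont.continuousAt
    exact ht.eventually (Metric.ball_mem_nhds 0 hη)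
  obtain ⟨ε, hε, hball⟩ := Metric.eventually_nhds_iff.1 hev
  refine ⟨ε, hε, fun S c hc => ?_⟩
  have h1 := hball ((dist_bzClassMap_apply_le S c b w).trans_lt hc)
  rwa [dist_zero_right] at h1

/-- **Split chart at a central place**: the split coordinate is pinned to its wall, `(eˣʷ − e⁻ˣʷ)² < η` on a small tube (`(eˣ−e⁻ˣ)² = ‖t² − 4d‖`).
[cite: Bouaziz1994IntegralesOrbitales, §5.1 p. 588] [cite: Shelstad1979, §4 p. 25] -/
theorem exists_forall_sq_exp_sub_lt_of_central (b : W → ℂ × ℂ × ℂ) {w : W} (hw : (b w).1 ^ 2 = 4 * (b w).2.1) {η : ℝ} (hη : 0 < η) :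
    ∃ ε : ℝ, 0 < ε ∧ ∀ (S : Finset W) (c : W → Fin 3 → ℝ), w ∈ S → dist (bzClassMap S c) b < ε → (Real.exp (c w 0) - Real.exp (-(c w 0))) ^ 2 < η := by
  obtain ⟨ε, hε, h⟩ := exists_forall_norm_sq_sub_four_mul_lt_of_central b hw hη
  refine ⟨ε, hε, fun S c hwS hc => ?_⟩
  have h1 := h S c hc
  rwa [sq_sub_four_mul_bzClassMap_of_mem hwS, norm_mul, norm_pow, Circle.norm_coe, one_pow, mul_one, Complex.norm_real, Real.norm_eq_abs,
    abs_of_nonneg (sq_nonneg _)] at h1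

/-- **Compact chart at a central place**: the two block angles are close modulo `2π`, `‖e^{iθ₀} − e^{iθ₂}‖² < η` on a small tube (`= ‖t² − 4d‖`).
[cite: Bouaziz1994IntegralesOrbitales, §5.1 p. 588] [cite: Shelstad1979, §4 p. 25] -/
theorem exists_forall_norm_circleExp_sub_sq_lt_of_central (b : W → ℂ × ℂ × ℂ) {w : W} (hw : (b w).1 ^ 2 = 4 * (b w).2.1) {η : ℝ} (hη : 0 < η) :
    ∃ ε : ℝ, 0 < ε ∧ ∀ (S : Finset W) (c : W → Fin 3 → ℝ), w ∉ S → dist (bzClassMap S c) b < ε →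
      ‖(Circle.exp (c w 0) : ℂ) - (Circle.exp (c w 2) : ℂ)‖ ^ 2 < η := by
  obtain ⟨ε, hε, h⟩ := exists_forall_norm_sq_sub_four_mul_lt_of_central b hw hη
  refine ⟨ε, hε, fun S c hwS hc => ?_⟩
  have h1 := h S c hc
  rwa [sq_sub_four_mul_bzClassMap_of_not_mem hwS, norm_pow] at h1

end WallClass

end Literature.NumberTheory.Rogawski1990

end
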